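import Summits.QuantumFields.BalabanUV.Beta.EriceRemainderEnclosureHistoryAutonomyComparisonAgeCompositionStaticChainBlockFluid
import Summits.QuantumFields.BalabanUV.Beta.EriceRemainderEnclosureHistoryAutonomyComparisonAgeCompositionStaticChainHyperbolic

/-!
# EriceRemainderEnclosureHistoryAutonomyComparisonAgeCompositionStaticChainBinMajorant — (E74d) THE WINDOW-MASS BIN MAJORANT, INSTANTIATED: for the crude static
# chain with defects `θ̄(a_i∕a_m)` and window masses `≤ Σ x_i a_m∕a_i`, cut into consecutive blocks, the numeric bin-chain recursion (closed forms alive, far-load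
# budgets) implies that EVERY MEMBER CLOSES and bounds the young age's chain load by the majorant masses — `V_maj` of README g64 §4 ∕ g65 §4 as one theorem

Cell `pub-balaban`, β-function sub-cell, BINDER row D4 «RemainderConst leaves for Bałaban's split» (`HOME/BINDER-OWNERS.md`; owner lineage `b2b-balaban-beta-an4`;
this file by co-owner #2 lineage `b2b-balaban-beta-d4-p2`, generation 65), β-FLOW TEAM duty (1), FREEZE (0) honoured (def-free; imports (E74c) `…StaticChainBlockFluid`
and (E72c) `…StaticChainHyperbolic`; uses `spike_step_le`, `spike_le_closed_form`, `q_mono`, `compounding_succ`, `consumed_mono` (E73a), `sum_rho_mul_compounding` (E72a),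
`carried_far_factor`, `block_beta_reindex`, `ratio_block_form`, `far_load_le`, `bin_chain`, `young_read_out_le`, `window_mass_block_le` (E74c), `thetabar_antitone`,
`thetabar_mem_unit_interval` (E72c) BY NAME; nothing restated).

HONEST FRAMING (page 1, verbatim and binding).  *"Discharging BetaPertH makes Bałaban's UV stability UNCONDITIONAL — a real constructive-QFT result; it is
NOT the continuum limit and NOT the Clay problem."*  THIS FILE DISCHARGES NOTHING OF THE KIND.  Finite-sum algebra and elementary real inequalities — hypotheses of
a census, not facts; the form, signs, ages and moments of Bałaban's (1.22) limit functional are NOT PRINTED ([I] p. 298; GAPS G-t4-U2-1∕-2) and NOT asserted.  Row D4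
class UNCHANGED (critical-path width 0; instance 0∕1; D4 DISCHARGE NO DATE).  HONEST DEPENDENCY: continuum YM on T⁴ ⇐ BetaPertH ∧ nine spine estimates (0/9 proved);
BetaPertH ⇐ (D1) ∧ (D4) ∧ CAP+tail; G-an2-4 gates asym, D1 and NE2/3/4.

THE POINT (census sense (α); route (N); README `g65/e74` §4–§6).  §1 **`block_le_closed_form'`** — (E74c)'s block fluid majorant WITHOUT the a-priori sign
hypothesis on the block's ratios: the far defects' non-negativity suffices, the signs are produced inside the member-by-member induction (a member's ratio is
non-negative because the earlier members closed).  §2 `thetabar_one_lt_one`, `thetabar_ratio_bounds` (within a block an older member is seen at ratio ≥ 1: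
defect in `[0, θ̄(1)]`).  §3 **`window_mass_bin_majorant`** — THE INSTANTIATION: ages `a_i > 0` oldest first, loads `x_i ≥ 0`, defects `θ_{m,i} = θ̄(a_i∕a_m)`,
window masses `Ω_m ≤ Σ_{i<m} x_i a_m∕a_i` ((E74a)'s window-mass chain; `Ω_m ≤ Ω^u`), consecutive non-empty blocks `[Bd β, Bd(β+1))` (ratio bins in the application),
and NUMERIC data `Λ_β ≥ 0`, `D_β ≤ 1 − top_β·Σ_{i<Bd β} x_i∕a_i`, `F_β ≥ 1` with the (E72e)∕(E73a) closed form (`a = 1 − θ̄(1)`, `θ = θ̄(1) + Λ_β`, `κ = κ' = 1`,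
`D₀ = D_β`) ALIVE at the block load `X_β` and of value `≤ F_β`, and the MAJORANT RECURSION `Σ_{β'<β} θ̄(bot_{β'}∕top_β)(F_{β'} − 1)Π_{β'<β''<β}F_{β''} ≤ Λ_β` ⟹
**every member of every block has ratio in `[0,1)`** and, for any reference age `z > 0` (the young age below the window), **`Σ_i θ̄(a_i∕z) b_{Bd n,i} ≤ Σ_β θ̄(bot_β∕z)(F_β − 1)Π_{β<β''<n}F_{β''}`**
— the `V_maj` of the bin-chain majorant, whose outer-budget version is finite and closing numerically for the window-mass chain (README g65/e74 §4: `Φ_T 0.20–0.28`,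
`Φ_ρ 0.70–0.77`).  With (E74b) (`young_max_load_antitone`, `min_edge_charge_le`: `x_z ≤ x^out(X)`) and (E74a) (`key_ratio_le_cap_add_product` ∕ `window_mass_step_closes`)
every quantity a certificate evaluates is now backed by a theorem; what a certificate must SUPPLY is the numeric data (Λ, D, F per bin) satisfying the displayed
inequalities for ALL admissible bin loads — the global optimisation of README §5 (3), OPEN.  §5 (appended): `young_window_mass_le`, **`young_closes`** (the glue:
`x_z ≤ x^out`, `V ≤ V_maj`, `Ω_z ≤ Ω_maj`, `x^out(1+V_maj) < 1 − Ω_maj` ⟹ the young's ratio closes).  NOT CLAIMED: any certified supremum; the static closure; the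
identification `Ω_m ≤ Ω^u` against (E71c); MONO; (E58′); anything nonlinear; anything printed.
-/
noncomputable section
open Finset

namespace Summit.QuantumFields.BalabanUV.Beta.EriceRemainderEnclosureHistoryAutonomyComparisonAgeCompositionStaticChainBinMajorant

open Summit.QuantumFields.BalabanUV.Beta.EriceRemainderEnclosureHistoryAutonomyComparisonAgeCompositionStaticChain
  (sum_rho_mul_compounding)
open Summit.QuantumFields.BalabanUV.Beta.EriceRemainderEnclosureHistoryAutonomyComparisonAgeCompositionStaticChainFluidDomination
  (spike_step_le spike_le_closed_form q_mono compounding_succ consumed_mono)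
open Summit.QuantumFields.BalabanUV.Beta.EriceRemainderEnclosureHistoryAutonomyComparisonAgeCompositionStaticChainBlockFluid
  (carried_far_factor block_beta_reindex ratio_block_form far_load_le bin_chain young_read_out_le window_mass_block_le)
open Summit.QuantumFields.BalabanUV.Beta.EriceRemainderEnclosureHistoryAutonomyComparisonAgeCompositionStaticChainHyperbolic
  (thetabar_mem_unit_interval thetabar_antitone)

/-! ## §1 The block majorant without an a-priori sign hypothesis on the ratios -/

/-- **THE BLOCK FLUID MAJORANT, SIGN-FREE FORM.**  (E74c) `block_le_closed_form` with the a-priori hypothesis `0 ≤ ρ_{B+m}` REPLACED by the non-negativity of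
the far defects `θ_{B+m,i} ≥ 0` (`i < B`): the signs of the ratios are then produced inside the member-by-member induction (a member's ratio is non-negative
because the earlier members closed, so every carried ratio it reads is non-negative).  Same conclusions (i)–(iii), plus `0 ≤ ρ_{B+m}`. [folklore] -/
theorem block_le_closed_form' {ρ x Ω t : ℕ → ℝ} {θ b : ℕ → ℕ → ℝ} {Θ : ℕ → ℝ} {B L : ℕ} {θin Λ D0 κ κ' : ℝ}
    (hρ : ∀ m, ρ m = x m * (1 + ∑ i ∈ range m, θ m i * b m i) / (1 - Ω m))
    (hnew : ∀ m, b (m + 1) m = ρ m / (1 - ρ m))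
    (hold : ∀ m i, i < m → b (m + 1) i = b m i / (1 - ρ m))
    (hx : ∀ m, 0 ≤ x (B + m))
    (hθin : ∀ m i, i < m → m < L → 0 ≤ θ (B + m) (B + i) ∧ θ (B + m) (B + i) ≤ θin) (hθin0 : 0 ≤ θin) (hθin1 : θin < 1)
    (hΘ : ∀ m i, m < L → i < B → 0 ≤ θ (B + m) i ∧ θ (B + m) i ≤ Θ i) (hb0 : ∀ i, i < B → 0 ≤ b B i)
    (hΛ : ∑ i ∈ range B, Θ i * b B i ≤ Λ) (hΛ0 : 0 ≤ Λ)
    (ht0 : t 0 = 0) (ht : ∀ m, t (m + 1) = t m + x (B + m))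
    (hΩ : ∀ m, m < L → D0 - κ * t m ≤ 1 - Ω (B + m)) (hκ0 : 0 ≤ κ) (hκκ' : κ ≤ κ') (haκ : 1 - θin ≤ κ')
    (hDL : 0 < D0 - κ' * t L)
    (hqL : (θin + Λ) * (Real.exp ((1 - θin) / κ' * (Real.log D0 - Real.log (D0 - κ' * t L))) / ((1 - θin) + (θin + Λ))) < 1) :
    (∀ m, m ≤ L →
      (∏ j ∈ range m, (1 - ρ (B + j))⁻¹) ≤ (1 - θin) * (Real.exp ((1 - θin) / κ' * (Real.log D0 - Real.log (D0 - κ' * t m))) / ((1 - θin) + (θin + Λ))) /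
        (1 - (θin + Λ) * (Real.exp ((1 - θin) / κ' * (Real.log D0 - Real.log (D0 - κ' * t m))) / ((1 - θin) + (θin + Λ))))
      ∧ (m < L → 0 ≤ ρ (B + m) ∧ ρ (B + m) < 1))
    ∧ (∀ i, i < B → b (B + L) i = b B i * ∏ j ∈ range L, (1 - ρ (B + j))⁻¹)
    ∧ (∑ i ∈ range L, b (B + L) (B + i) = (∏ j ∈ range L, (1 - ρ (B + j))⁻¹) - 1) := by
  set ρ' : ℕ → ℝ := fun m => ρ (B + m) with hρ'def
  set h : ℕ → ℝ := fun m => x (B + m) with hhdef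
  set E : ℕ → ℝ := fun m => ∏ j ∈ range m, (1 - ρ (B + j))⁻¹ with hEdef
  have hh : ∀ m, 0 ≤ h m := fun m => hx m
  have hE0 : E 0 = 1 := by simp [hEdef]
  have hE : ∀ m, E (m + 1) = E m / (1 - ρ' m) := fun m => compounding_succ ρ' m
  have ha : 0 < 1 - θin := by linarith
  have hκ'0 : 0 ≤ κ' := hκ0.trans hκκ'
  have haθ : 0 < (1 - θin) + (θin + Λ) := by linarith
  have htmono : ∀ m n, m ≤ n → t m ≤ t n := fun m n hmn => consumed_mono hh ht hmn
  have ht00 : ∀ m, 0 ≤ t m := fun m => by rw [← ht0]; exact htmono 0 m (Nat.zero_le m)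
  have hDm : ∀ m, m ≤ L → 0 < D0 - κ' * t m := fun m hm => by nlinarith [htmono m L hm]
  have hDen : ∀ m, m ≤ L → 0 < D0 - κ * t m := fun m hm => by
    have := hDm m hm; nlinarith [ht00 m, htmono m L hm]
  have hqm : ∀ m, m ≤ L →
      (θin + Λ) * (Real.exp ((1 - θin) / κ' * (Real.log D0 - Real.log (D0 - κ' * t m))) / ((1 - θin) + (θin + Λ))) < 1 :=
    fun m hm => lt_of_le_of_lt (mul_le_mul_of_nonneg_left (q_mono ha.le hκ'0 haθ (htmono m L hm) hDL) (by linarith)) hqL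
  -- signs AND step inequalities, member by member
  have hS : ∀ n, n ≤ L → ∀ j, j < n → 0 ≤ ρ' j ∧ ρ' j ≤ h j * (((1 - θin) + (θin + Λ) * E j) / (D0 - κ * t j)) := by
    intro n
    induction n with
    | zero => intro _ j hj; omega
    | succ n ih =>
      intro hn j hj
      have hn' : n < L := Nat.lt_of_succ_le hn
      have hSn := ih hn'.le
      rcases Nat.lt_succ_iff_lt_or_eq.mp hj with hjn | hjn
      · exact hSn j hjn
      · subst hjn
        have hcl := spike_le_closed_form (ρ := ρ') (h := h) (t := t) (E := E) ha haκ (by linarith) hκκ' hh ht0 ht hE0 hE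
          (fun i hi => (hSn i hi).2) (hDm j hn'.le) (hqm j hn'.le)
        have hρ1 : ∀ i, i < j → ρ' i < 1 := fun i hi => (hcl i hi.le).2 hi
        have hρ0 : ∀ i, i < j → 0 ≤ ρ' i := fun i hi => (hSn i hi).1
        have hform := ratio_block_form hρ hnew hold B j
        -- sign of member j: every carried ratio it reads is non-negative
        have hPnn : ∀ i, 0 ≤ ∏ j' ∈ Ico i j, (1 - ρ (B + j'))⁻¹ := fun i =>
          prod_nonneg fun j' hj' => inv_nonneg.mpr (by linarith [hρ1 j' (mem_Ico.mp hj').2])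
        have hsign : 0 ≤ ρ' j := by
          have hfar0 : 0 ≤ ∑ i ∈ range B, θ (B + j) i * b (B + j) i := sum_nonneg fun i hi => by
            have hiB := mem_range.mp hi
            rw [carried_far_factor hold B hiB j]
            exact mul_nonneg (hΘ j i hn' hiB).1 (mul_nonneg (hb0 i hiB)
              (prod_nonneg fun j' hj' => inv_nonneg.mpr (by linarith [hρ1 j' (mem_range.mp hj')])))
          have hblk0 : 0 ≤ ∑ i' ∈ range j, θ (B + j) (B + i') * (ρ (B + i') * ∏ j' ∈ Ico i' j, (1 - ρ (B + j'))⁻¹) :=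
            sum_nonneg fun i' hi' => mul_nonneg (hθin j i' (mem_range.mp hi') hn').1 (mul_nonneg (hρ0 i' (mem_range.mp hi')) (hPnn i'))
          have hden : 0 < 1 - Ω (B + j) := lt_of_lt_of_le (hDen j hn'.le) (hΩ j hn')
          show 0 ≤ ρ (B + j)
          rw [hform]
          exact div_nonneg (mul_nonneg (hx j) (by linarith)) hden.le
        have hstep := spike_step_le (x := fun m => x (B + m)) (ρ := ρ') (Ω := fun m => Ω (B + m)) (t := t)
          (Lfar := fun m => ∑ i ∈ range B, θ (B + m) i * b (B + m) i) (θm := fun m i => θ (B + m) (B + i))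
          (θ := θin) (Λ := Λ) (D0 := D0) (κ := κ) (m := j)
          hform (hx j) hρ0 hρ1 (fun i hi => hθin j i hi hn') hθin0 hθin1.le hΛ0
          (le_trans (far_load_le hold B j (fun i hi => (hΘ j i hn' hi).2) hb0 hρ1)
            (mul_le_mul_of_nonneg_right hΛ (prod_nonneg fun i hi => inv_nonneg.mpr (by linarith [hρ1 i (mem_range.mp hi)]))))
          (hΩ j hn') (hDen j hn'.le)
        exact ⟨hsign, by simpa [hhdef, hEdef] using hstep⟩
  have hmain := spike_le_closed_form (ρ := ρ') (h := h) (t := t) (E := E) ha haκ (by linarith) hκκ' hh ht0 ht hE0 hE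
    (fun j hj => (hS L le_rfl j hj).2) hDL hqL
  refine ⟨fun m hm => ⟨(hmain m hm).1, fun hmL => ⟨(hS L le_rfl m hmL).1, (hmain m hm).2 hmL⟩⟩,
    fun i hi => carried_far_factor hold B hi L, ?_⟩
  have hρne : ∀ j, j < L → ρ' j ≠ 1 := fun j hj => ((hmain j hj.le).2 hj).ne
  rw [← sum_rho_mul_compounding hρne]
  exact sum_congr rfl fun i hi => block_beta_reindex hnew hold B (mem_range.mp hi)

/-! ## §2 The defect `θ̄` of the crude chain: the constants a block needs -/

/-- `θ̄(1) < 1` (indeed `θ̄(1) = 1 − (1∕2)√(1∕2)·e^{−1∕2} ≈ 0.7856`). [folklore] -/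
theorem thetabar_one_lt_one : 1 - (1:ℝ) / (1 + 1) * Real.sqrt (1 / (1 + 1)) * Real.exp (-(1 / (2 * 1))) < 1 := by
  have h1 : 0 < Real.sqrt (1 / (1 + 1) : ℝ) := Real.sqrt_pos.mpr (by norm_num)
  have h2 : 0 < Real.exp (-(1 / (2 * 1)) : ℝ) := Real.exp_pos _
  nlinarith [mul_pos h1 h2]

/-- Within a block (ages non-increasing in the index), a member sees an OLDER member at ratio `≥ 1`, so its defect is in `[0, θ̄(1)]`; towards any age it is in
`[0,1]`; and it is monotone in both ages through the ratio ((E72c) `thetabar_antitone`, `thetabar_mem_unit_interval`). [folklore] -/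
theorem thetabar_ratio_bounds {a : ℕ → ℝ} (ha0 : ∀ i, 0 < a i) (hmono : ∀ i j, i ≤ j → a j ≤ a i) {i m : ℕ} (him : i ≤ m) :
    0 ≤ 1 - (a i / a m) / (a i / a m + 1) * Real.sqrt ((a i / a m) / (a i / a m + 1)) * Real.exp (-(1 / (2 * (a i / a m)))) ∧
    1 - (a i / a m) / (a i / a m + 1) * Real.sqrt ((a i / a m) / (a i / a m + 1)) * Real.exp (-(1 / (2 * (a i / a m)))) ≤
      1 - (1:ℝ) / (1 + 1) * Real.sqrt (1 / (1 + 1)) * Real.exp (-(1 / (2 * 1))) := by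
  have hr : 0 < a i / a m := div_pos (ha0 i) (ha0 m)
  have h1 : (1:ℝ) ≤ a i / a m := by rw [le_div_iff₀ (ha0 m), one_mul]; exact hmono i m him
  exact ⟨(thetabar_mem_unit_interval hr).1, thetabar_antitone one_pos h1⟩

/-! ## §3 THE WINDOW-MASS BIN MAJORANT (instantiated) -/

/-- **THE WINDOW-MASS BIN MAJORANT.**  The crude static chain of route (N) with the WINDOW-MASS denominator ((E74a)): ages `a_i > 0` oldest first, loads `x_i ≥ 0`,
defects `θ_{m,i} = θ̄(a_i∕a_m)`, window masses `Ω_m ≤ Σ_{i<m} x_i·a_m∕a_i`, ratios and carried ratios as in (E72a).  Cut the ages into consecutive NON-EMPTY blocks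
`[Bd β, Bd(β+1))`, `β < n` (ratio bins in the application), with block loads `X_β = Σ_{i∈blk β} x_i`.  NUMERIC DATA per block: `Λ_β ≥ 0` (incoming far load),
`D_β ≤ 1 − a_{Bd β}·Σ_{i<Bd β} x_i∕a_i` (incoming window mass, e.g. `1 − top_β·Σ_{β'<β} X_{β'}∕bot_{β'}`), `F_β ≥ 1`, such that the constant-coefficient closed form of
(E72e)∕(E73a) with `a = 1 − θ̄(1)`, `θ = θ̄(1) + Λ_β`, `κ = κ' = 1`, `D₀ = D_β` is ALIVE at `X_β` (`D_β − X_β > 0`, `(θ̄(1)+Λ_β)·q_β(X_β) < 1`) with value `≤ F_β`, and the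
MAJORANT RECURSION `Σ_{β'<β} θ̄(bot_{β'}∕top_β)·(F_{β'} − 1)·Π_{β'<β''<β} F_{β''} ≤ Λ_β` holds (`bot`∕`top` = youngest∕oldest age of a block).  THEN: every member of
every block has ratio in `[0,1)` — THE CHAIN CLOSES ON THE WHOLE WINDOW — and a young age `z > 0` below the window reads a chain load
`Σ_{i<Bd n} θ̄(a_i∕z)·b_{Bd n,i} ≤ Σ_{β<n} θ̄(bot_β∕z)·(F_β − 1)·Π_{β<β''<n} F_{β''}` — the functional `V_maj` of README g64/e73 §4 ∕ g65/e74 §4, now a theorem.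
((E74c) `bin_chain` + §1 `block_le_closed_form'` per block + (E74c) `window_mass_block_le` + `young_read_out_le` + (E72c) `thetabar_antitone`.)  With (E74b)'s outer
charges for the young's maximal load (`young_max_load_antitone`, `min_edge_charge_le`) and (E74a)'s normal form this is everything a certificate has to evaluate.
[folklore] -/
theorem window_mass_bin_majorant {a x Ω ρ : ℕ → ℝ} {θ b : ℕ → ℕ → ℝ} {Bd : ℕ → ℕ} {n : ℕ} {Λ D F : ℕ → ℝ}
    (ha0 : ∀ i, 0 < a i) (hamono : ∀ i j, i ≤ j → a j ≤ a i) (hx : ∀ i, 0 ≤ x i)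
    (hθ : ∀ m i, i < m → θ m i =
      1 - (a i / a m) / (a i / a m + 1) * Real.sqrt ((a i / a m) / (a i / a m + 1)) * Real.exp (-(1 / (2 * (a i / a m)))))
    (hΩ : ∀ m, Ω m ≤ ∑ i ∈ range m, x i * (a m / a i))
    (hρ : ∀ m, ρ m = x m * (1 + ∑ i ∈ range m, θ m i * b m i) / (1 - Ω m))
    (hnew : ∀ m, b (m + 1) m = ρ m / (1 - ρ m))
    (hold : ∀ m i, i < m → b (m + 1) i = b m i / (1 - ρ m))
    (hBd0 : Bd 0 = 0) (hBd : ∀ β, Bd β < Bd (β + 1))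
    (hΛ0 : ∀ β, β < n → 0 ≤ Λ β) (hF1 : ∀ β, 1 ≤ F β)
    (hD : ∀ β, β < n → D β ≤ 1 - a (Bd β) * ∑ i ∈ range (Bd β), x i / a i)
    (hDX : ∀ β, β < n → 0 < D β - 1 * ∑ i ∈ Ico (Bd β) (Bd (β + 1)), x i)
    (hq : ∀ β, β < n → ((1 - (1:ℝ) / (1 + 1) * Real.sqrt (1 / (1 + 1)) * Real.exp (-(1 / (2 * 1)))) + Λ β) *
      (Real.exp ((1 - (1 - (1:ℝ) / (1 + 1) * Real.sqrt (1 / (1 + 1)) * Real.exp (-(1 / (2 * 1))))) / 1 *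
        (Real.log (D β) - Real.log (D β - 1 * ∑ i ∈ Ico (Bd β) (Bd (β + 1)), x i))) /
        ((1 - (1 - (1:ℝ) / (1 + 1) * Real.sqrt (1 / (1 + 1)) * Real.exp (-(1 / (2 * 1))))) +
          ((1 - (1:ℝ) / (1 + 1) * Real.sqrt (1 / (1 + 1)) * Real.exp (-(1 / (2 * 1)))) + Λ β))) < 1)
    (hF : ∀ β, β < n →
      (1 - (1 - (1:ℝ) / (1 + 1) * Real.sqrt (1 / (1 + 1)) * Real.exp (-(1 / (2 * 1))))) *
        (Real.exp ((1 - (1 - (1:ℝ) / (1 + 1) * Real.sqrt (1 / (1 + 1)) * Real.exp (-(1 / (2 * 1))))) / 1 *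
          (Real.log (D β) - Real.log (D β - 1 * ∑ i ∈ Ico (Bd β) (Bd (β + 1)), x i))) /
          ((1 - (1 - (1:ℝ) / (1 + 1) * Real.sqrt (1 / (1 + 1)) * Real.exp (-(1 / (2 * 1))))) +
            ((1 - (1:ℝ) / (1 + 1) * Real.sqrt (1 / (1 + 1)) * Real.exp (-(1 / (2 * 1)))) + Λ β))) /
        (1 - ((1 - (1:ℝ) / (1 + 1) * Real.sqrt (1 / (1 + 1)) * Real.exp (-(1 / (2 * 1)))) + Λ β) *
          (Real.exp ((1 - (1 - (1:ℝ) / (1 + 1) * Real.sqrt (1 / (1 + 1)) * Real.exp (-(1 / (2 * 1))))) / 1 *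
            (Real.log (D β) - Real.log (D β - 1 * ∑ i ∈ Ico (Bd β) (Bd (β + 1)), x i))) /
            ((1 - (1 - (1:ℝ) / (1 + 1) * Real.sqrt (1 / (1 + 1)) * Real.exp (-(1 / (2 * 1))))) +
              ((1 - (1:ℝ) / (1 + 1) * Real.sqrt (1 / (1 + 1)) * Real.exp (-(1 / (2 * 1)))) + Λ β)))) ≤ F β)
    (hrec : ∀ β, β < n → ∑ β' ∈ range β,
      (1 - (a (Bd (β' + 1) - 1) / a (Bd β)) / (a (Bd (β' + 1) - 1) / a (Bd β) + 1) *
        Real.sqrt ((a (Bd (β' + 1) - 1) / a (Bd β)) / (a (Bd (β' + 1) - 1) / a (Bd β) + 1)) *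
        Real.exp (-(1 / (2 * (a (Bd (β' + 1) - 1) / a (Bd β)))))) * ((F β' - 1) * ∏ β'' ∈ Ico (β' + 1) β, F β'') ≤ Λ β) :
    (∀ β, β < n → ∀ m, m < Bd (β + 1) - Bd β → 0 ≤ ρ (Bd β + m) ∧ ρ (Bd β + m) < 1) ∧
    (∀ z : ℝ, 0 < z →
      ∑ i ∈ range (Bd n), (1 - (a i / z) / (a i / z + 1) * Real.sqrt ((a i / z) / (a i / z + 1)) * Real.exp (-(1 / (2 * (a i / z))))) * b (Bd n) i ≤
      ∑ β ∈ range n, (1 - (a (Bd (β + 1) - 1) / z) / (a (Bd (β + 1) - 1) / z + 1) *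
        Real.sqrt ((a (Bd (β + 1) - 1) / z) / (a (Bd (β + 1) - 1) / z + 1)) * Real.exp (-(1 / (2 * (a (Bd (β + 1) - 1) / z))))) *
        ((F β - 1) * ∏ β'' ∈ Ico (β + 1) n, F β'')) := by
  -- θ̄ in one letter
  set TB : ℝ → ℝ := fun r => 1 - r / (r + 1) * Real.sqrt (r / (r + 1)) * Real.exp (-(1 / (2 * r))) with hTB
  have hTB1 : TB 1 < 1 := thetabar_one_lt_one
  have hTB0 : ∀ r, 0 < r → 0 ≤ TB r ∧ TB r ≤ 1 := fun r hr => thetabar_mem_unit_interval hr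
  have hTBanti : ∀ r r', 0 < r → r ≤ r' → TB r' ≤ TB r := fun r r' hr hrr' => thetabar_antitone hr hrr'
  have hTB10 : 0 ≤ TB 1 := (hTB0 1 one_pos).1
  have hBdmono : ∀ β' β, β' ≤ β → Bd β' ≤ Bd β := fun β' β h => monotone_nat_of_le_succ (fun k => (hBd k).le) h
  -- the per-block step: §1 with the window-mass constants
  have hstep : ∀ β, β < n → (∀ i, i < Bd β → 0 ≤ b (Bd β) i) →
      (∑ i ∈ range (Bd β), θ (Bd β) i * b (Bd β) i ≤ Λ β) →
      (∀ m, m < Bd (β + 1) - Bd β → 0 ≤ ρ (Bd β + m) ∧ ρ (Bd β + m) < 1) ∧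
        (∏ j ∈ range (Bd (β + 1) - Bd β), (1 - ρ (Bd β + j))⁻¹) ≤ F β := by
    intro β hβ hb0 hΛβ
    set B := Bd β with hB
    set L := Bd (β + 1) - Bd β with hL
    have hBL : Bd (β + 1) = B + L := by have := hBd β; omega
    -- consumed load inside the block
    set t : ℕ → ℝ := fun m => ∑ i ∈ range m, x (B + i) with htdef
    have ht0 : t 0 = 0 := by simp [htdef]
    have ht : ∀ m, t (m + 1) = t m + x (B + m) := fun m => by simp [htdef, sum_range_succ]
    have htL : t L = ∑ i ∈ Ico (Bd β) (Bd (β + 1)), x i := by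
      simp only [htdef]; rw [hBL, range_eq_Ico, sum_Ico_add (fun i => x i) 0 L B, zero_add, add_comm L B]
    have hblk := block_le_closed_form' (B := B) (L := L) (θin := TB 1) (Λ := Λ β) (D0 := D β) (κ := 1) (κ' := 1) (Θ := fun i => θ B i)
      (t := t) hρ hnew hold (fun m => hx (B + m))
      (fun m i hi hm => by
        rw [hθ (B + m) (B + i) (by omega)]
        exact thetabar_ratio_bounds ha0 hamono (by omega))
      hTB10 hTB1
      (fun m i hm hi => by
        rw [hθ (B + m) i (by omega), hθ B i hi]
        refine ⟨(hTB0 _ (div_pos (ha0 i) (ha0 (B + m)))).1, hTBanti _ _ (div_pos (ha0 i) (ha0 B)) ?_⟩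
        exact div_le_div_of_nonneg_left (ha0 i).le (ha0 (B + m)) (hamono B (B + m) (Nat.le_add_right B m)))
      hb0 hΛβ (hΛ0 β hβ) ht0 ht
      (fun m hm => by
        have hw := window_mass_block_le ha0 hamono hx B m
        have hΩm := hΩ (B + m)
        have hDβ := hD β hβ
        show D β - 1 * t m ≤ 1 - Ω (B + m)
        simp only [htdef]; linarith)
      zero_le_one le_rfl (by linarith) (by rw [htL]; exact hDX β hβ) (by rw [htL]; exact hq β hβ)
    obtain ⟨hmem, _, _⟩ := hblk
    refine ⟨fun m hm => (hmem m hm.le).2 hm, ?_⟩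
    have hEL := (hmem L le_rfl).1
    rw [htL] at hEL
    exact hEL.trans (hF β hβ)
  -- the iteration
  have hchain := bin_chain (θfar := fun β i => θ (Bd β) i) (Θbar := fun β β' => TB (a (Bd (β' + 1) - 1) / a (Bd β)))
    (F := F) (Λ := Λ) (n := n) hnew hold hBd0 (fun β => (hBd β).le) hF1
    (fun β β' => (hTB0 _ (div_pos (ha0 _) (ha0 _))).1)
    (fun β β' i hβ' hi1 hi2 => by
      show θ (Bd β) i ≤ TB (a (Bd (β' + 1) - 1) / a (Bd β))
      rw [hθ (Bd β) i (lt_of_lt_of_le hi2 (hBdmono (β' + 1) β hβ'))]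
      exact hTBanti _ _ (div_pos (ha0 _) (ha0 _)) (div_le_div_of_nonneg_right (hamono i (Bd (β' + 1) - 1) (by omega)) (ha0 _).le))
    hrec hstep
  obtain ⟨hb0n, hSn, hcln⟩ := hchain n le_rfl
  refine ⟨fun β hβ m hm => ?_, fun z hz => ?_⟩
  · -- closure with signs: re-run the block step at β (signs come from §1)
    obtain ⟨hb0β, _, _⟩ := hchain β hβ.le
    have hfar : ∑ i ∈ range (Bd β), θ (Bd β) i * b (Bd β) i ≤ Λ β := by
      -- as inside `bin_chain`: cut into earlier blocks and use their mass bounds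
      obtain ⟨_, hSβ, _⟩ := hchain β hβ.le
      have key : ∀ k, k ≤ β → ∑ i ∈ range (Bd k), θ (Bd β) i * b (Bd β) i =
          ∑ β' ∈ range k, ∑ i ∈ Ico (Bd β') (Bd (β' + 1)), θ (Bd β) i * b (Bd β) i := by
        intro k; induction k with
        | zero => intro _; simp [hBd0]
        | succ k ihk => intro hk; rw [sum_range_succ, ← ihk (Nat.le_of_succ_le hk), ← sum_range_add_sum_Ico _ (hBd k).le]
      rw [key β le_rfl]
      refine le_trans (sum_le_sum fun β' hβ' => ?_) (hrec β hβ)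
      have hβ'β : β' < β := mem_range.mp hβ'
      calc ∑ i ∈ Ico (Bd β') (Bd (β' + 1)), θ (Bd β) i * b (Bd β) i
          ≤ ∑ i ∈ Ico (Bd β') (Bd (β' + 1)), TB (a (Bd (β' + 1) - 1) / a (Bd β)) * b (Bd β) i :=
            sum_le_sum fun i hi => by
              have hi' := mem_Ico.mp hi
              have hiB : i < Bd β := lt_of_lt_of_le hi'.2 (hBdmono (β' + 1) β hβ'β)
              rw [hθ (Bd β) i hiB]
              exact mul_le_mul_of_nonneg_right
                (hTBanti _ _ (div_pos (ha0 _) (ha0 _)) (div_le_div_of_nonneg_right (hamono i (Bd (β' + 1) - 1) (by omega)) (ha0 _).le))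
                (hb0β i hiB)
        _ = TB (a (Bd (β' + 1) - 1) / a (Bd β)) * ∑ i ∈ Ico (Bd β') (Bd (β' + 1)), b (Bd β) i := by rw [mul_sum]
        _ ≤ TB (a (Bd (β' + 1) - 1) / a (Bd β)) * ((F β' - 1) * ∏ β'' ∈ Ico (β' + 1) β, F β'') :=
            mul_le_mul_of_nonneg_left (hSβ β' hβ'β) (hTB0 _ (div_pos (ha0 _) (ha0 _))).1
    exact (hstep β hβ hb0β hfar).1 m hm
  · -- the young's read-out
    exact young_read_out_le (θz := fun i => TB (a i / z)) (ϑ := fun β' => TB (a (Bd (β' + 1) - 1) / z)) hBd0 (fun β => (hBd β).le)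
      (fun β' => (hTB0 _ (div_pos (ha0 _) hz)).1)
      (fun β' i hβ' hi1 hi2 => hTBanti _ _ (div_pos (ha0 _) hz) (div_le_div_of_nonneg_right (hamono i (Bd (β' + 1) - 1) (by omega)) hz.le))
      hb0n hSn

/-! ## §4 The incoming window mass from bin loads -/

/-- **INCOMING WINDOW MASS FROM BIN LOADS.**  With non-empty blocks and ages non-increasing in the index, `Σ_{i<Bd β} x_i∕a_i ≤ Σ_{β'<β} X_{β'}∕bot_{β'}`
(`bot_{β'} = a_{Bd(β'+1)−1}`, the youngest = smallest age of block `β'`), so `D_β := 1 − top_β·Σ_{β'<β} X_{β'}∕bot_{β'}` satisfies the hypothesis `hD` of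
`window_mass_bin_majorant` — the incoming window mass is a function of the BIN LOADS, as in the numerics (`u4.py`). [folklore] -/
theorem incoming_window_mass_le {a x : ℕ → ℝ} {Bd : ℕ → ℕ} (ha0 : ∀ i, 0 < a i) (hamono : ∀ i j, i ≤ j → a j ≤ a i) (hx : ∀ i, 0 ≤ x i)
    (hBd0 : Bd 0 = 0) (hBd : ∀ β, Bd β < Bd (β + 1)) (β : ℕ) :
    ∑ i ∈ range (Bd β), x i / a i ≤ ∑ β' ∈ range β, (∑ i ∈ Ico (Bd β') (Bd (β' + 1)), x i) / a (Bd (β' + 1) - 1) := by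
  have key : ∀ k, ∑ i ∈ range (Bd k), x i / a i = ∑ β' ∈ range k, ∑ i ∈ Ico (Bd β') (Bd (β' + 1)), x i / a i := by
    intro k
    induction k with
    | zero => simp [hBd0]
    | succ k ihk => rw [sum_range_succ, ← ihk, ← sum_range_add_sum_Ico _ (hBd k).le]
  rw [key β]
  refine sum_le_sum fun β' _ => ?_
  rw [sum_div]
  refine sum_le_sum fun i hi => ?_
  have hi' := (mem_Ico.mp hi).2
  exact div_le_div_of_nonneg_left (hx i) (ha0 _) (hamono i (Bd (β' + 1) - 1) (by omega))

/-! ## §5 (appended, same generation) The young age below the window closes -/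

/-- The young's window mass from bin loads: `Σ_{i<Bd n} x_i·(z∕a_i) ≤ z·Σ_{β<n} X_β∕bot_β` (`incoming_window_mass_le` at the end of the window). [folklore] -/
theorem young_window_mass_le {a x : ℕ → ℝ} {Bd : ℕ → ℕ} {z : ℝ} (hz : 0 ≤ z) (ha0 : ∀ i, 0 < a i) (hamono : ∀ i j, i ≤ j → a j ≤ a i)
    (hx : ∀ i, 0 ≤ x i) (hBd0 : Bd 0 = 0) (hBd : ∀ β, Bd β < Bd (β + 1)) (n : ℕ) :
    ∑ i ∈ range (Bd n), x i * (z / a i) ≤ z * ∑ β ∈ range n, (∑ i ∈ Ico (Bd β) (Bd (β + 1)), x i) / a (Bd (β + 1) - 1) := by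
  have h := incoming_window_mass_le ha0 hamono hx hBd0 hBd n
  have heq : ∑ i ∈ range (Bd n), x i * (z / a i) = z * ∑ i ∈ range (Bd n), x i / a i := by
    rw [mul_sum]; exact sum_congr rfl fun i _ => by ring
  rw [heq]
  exact mul_le_mul_of_nonneg_left h hz

/-- **THE YOUNG AGE CLOSES (the glue).**  For the young age `z` below the window: load `0 ≤ x_z ≤ x^out` ((E74b): outer charges enlarge the feasible load), chain
load `V ≤ V_maj` (`window_mass_bin_majorant`, with `1 + V ≥ 0`), window mass `Ω_z ≤ Ω_maj` (`young_window_mass_le`), and the NUMERIC inequality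
`x^out·(1 + V_maj) < 1 − Ω_maj` ⟹ the young's window-mass ratio closes: `0 < 1 − Ω_z` and `x_z(1 + V)∕(1 − Ω_z) < 1`.  Together with `window_mass_bin_majorant`
(every window member closes) this is «numeric bin recursion + one numeric inequality ⟹ the window-mass chain closes at the young and on the whole window»; the
equivalent product form is (E74a) `key_ratio_le_cap_add_product`. [folklore] -/
theorem young_closes {x xout V Vmaj Ω Ωmaj : ℝ} (hx0 : 0 ≤ x) (hx : x ≤ xout) (hV : V ≤ Vmaj) (hV0 : 0 ≤ 1 + V) (hΩ : Ω ≤ Ωmaj)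
    (hnum : xout * (1 + Vmaj) < 1 - Ωmaj) :
    0 < 1 - Ω ∧ x * (1 + V) / (1 - Ω) < 1 := by
  have hxo : 0 ≤ xout := hx0.trans hx
  have h1 : x * (1 + V) ≤ xout * (1 + Vmaj) :=
    (mul_le_mul_of_nonneg_right hx hV0).trans (mul_le_mul_of_nonneg_left (by linarith) hxo)
  have hpos : 0 < 1 - Ω := by nlinarith [mul_nonneg hxo (show (0:ℝ) ≤ 1 + Vmaj by linarith)]
  refine ⟨hpos, ?_⟩
  rw [div_lt_one hpos]
  linarith

end Summit.QuantumFields.BalabanUV.Beta.EriceRemainderEnclosureHistoryAutonomyComparisonAgeCompositionStaticChainBinMajorant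

end
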